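import Summits.BirchSwinnertonDyer.BirchSwinnertonDyer.Theorems.GenusKolyvaginAtTwoPowDvdShaCardAtTwoRTLevelRange
import Literature.NumberTheory.EllipticCurves.LocalRestrictionDegreeTorsion
import Literature.NumberTheory.EllipticCurves.ArchimedeanH1CardLeTwo
import Literature.NumberTheory.EllipticCurves.SelmerTorsionRestrictionExact
import Literature.NumberTheory.EllipticCurves.CasselsTateLemma615
import HarnessLib

/-!
# Route `GenusKolyvaginAtTwo`, crux L_T `PowDvdShaCardAtTwoRT` (stmt-BirchSwinnertonDyer-23242), LINE 18 stub L, bottom rung: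
# THE `hX` PRODUCER — a class relaxed-Selmer along a quadratic extension, DOUBLED, lies in `H¹_{𝓛,⊤ on T}` (`kummerOutside`)

LEAD seat `bsd-line-gk2-p1` g16 (cell `bsd-f1-sign2`), `--supports 23242 --as helper`.  THEOREMS ONLY; no `sorry`; standard axioms.
BSD is NOT proved by any of this; neither is the crux nor stub L.

WHY (memo `Cruxes/PowDvdShaCardAtTwoRT/Lines/plus-descent-lead-g16.md` §2, §10).  The bottom-rung reciprocity step
`…RTBottomRungReciprocity.invWeilPairing_eq_zero_of_bottomRung` displays `hX : (2:ℕ) • Z ∈ kummerOutside W n (insert l' (s ∪ t))`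
for the class `Z ∈ H¹(ℚ, E^ε[n])` descended from a Kolyvagin class over the Heegner field `L = K(√d)`.  Such a `Z` is only RELAXED
off the own primes: its restriction to `L` satisfies the Kummer condition at every place of `L` prime to the own primes
(McCallum 1991 Lemma 4.3), i.e. `Z` satisfies the `L_w`-condition, not the `K_v`-one — at the primes ramified in `L`, at the inert
primes, and at the archimedean place alike.  The tree already knows that DOUBLING repairs this at every single place
(`Literature.….LocalRestrictionDegree(Torsion)`: `[L_w : K_v] ≤ [L : K] ≤ 2` kills `ker(H¹(K_v,E) → H¹(L_w,E))`, Dokchitser–Dokchitser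
2010 proof of Lemma 4.14; gk2-p2's `…RTRelaxedDoubling` is the `[L_w : K_v] = 2` case).  This file PACKAGES it in the currency of the
reciprocity step:
* §1 same-level local forms: `two_nsmul_mem_selmerLocalKer_of_resTorsion_mem` (finite `w ∣ v`, `[L : K] ≤ 2`),
  `two_nsmul_mem_selmerLocalKer_infinitePlace` (ANY class, any infinite place, no `L`: the archimedean condition has index `≤ 2`,
  `index_selmerLocalKer_infinitePlace_le_two`), and the `∀ w ∣ v` form;
* §2 **`two_nsmul_mem_kummerOutside_of_forall_resTorsion_mem`**: if `res_{L/K} ξ` satisfies the Kummer condition at every finite place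
  of `L` above every finite place `v ∉ T` of `K`, then `(2:ℕ) • ξ ∈ kummerOutside W m T` — no hypothesis at the infinite places, no
  hypothesis at the places in `T`; and the Selmer-group form `two_nsmul_mem_kummerOutside_of_resTorsion_mem_selmerGroup`.
In the engine (`K = ℚ`, `L` the Heegner field, `T = s ∪ t ∪ {ℓ′}` the own primes, `m = 4`): `hX` holds for `X = 2Z` with NO
condition on the auxiliary class at `d_L`, at `2`, or at `∞` beyond its own Kummer condition — the «no `δ`» feature of memo §2.
Namespace `…Theorems.GenusExact.RelaxedCount` (this lineage).  Closes nothing.  BSD is NOT proved by any of this.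

References: [DokchitserDokchitserAnnals2010] Lemma 4.14 (proof); [SerreGaloisCohomology1997] I.§2.4 Cor. to Prop. 9;
[McCallumLMS1991] §4 Lemma 4.3, Lemma 4.6; [MilneADT2006] I Rem. 3.7, I §6 Lemma 6.15.
-/

set_option autoImplicit false
-- the Theorems namespace of this sub repeats the summit name by design (D-0017 nested layout)
set_option linter.dupNamespace false

noncomputable section

open scoped Classical

open Field NumberField IsDedekindDomain Function WeierstrassCurve
open Literature.NumberTheory.EllipticCurves
open Literature.NumberTheory.GaloisRepresentations

namespace Summit.BirchSwinnertonDyer.BirchSwinnertonDyer.Theorems.GenusExact.RelaxedCount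

/-! ## §1 Same-level local doubling -/

section Local

variable {K : Type} [Field K] [NumberField K] (W : WeierstrassCurve K)
variable (L : Type) [Field L] [NumberField L] [Algebra K L]

/-- **Finite place, same level: `res ξ` Kummer at `L_w` ⟹ `2·ξ` Kummer at `K_v`** (`w ∣ v`, `[L : K] ≤ 2`).  The Selmer local
condition is the vanishing of the image in `H¹(·, E)` (`mem_selmerLocalKer_iff_torsionH1ToH1_mem`), images commute with restriction
(`torsionH1ToH1_resTorsion`, `mem_localRestrictionKer_iff_resBaseChange_mem`), and a class of `H¹(K, E)` dying over `L_w` with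
`[L_w : K_v] ≤ [L : K] ≤ 2` is killed by `2` over `K_v` (`two_nsmul_mem_localRestrictionKer_of_tower`,
`finrank_adicCompletion_le_of_liesOver`).  Same-level twin of the tree's `torsionH1ZSMul_two_mem_selmerLocalKer_of_resTorsion_mem`.
[cite: DokchitserDokchitserAnnals2010, Lemma 4.14 (proof)] [cite: SerreGaloisCohomology1997, I.§2.4 Cor. to Prop. 9] -/
theorem two_nsmul_mem_selmerLocalKer_of_resTorsion_mem (h2 : Module.finrank K L ≤ 2) (n : ℤ)
    (v : HeightOneSpectrum (𝓞 K)) (w : HeightOneSpectrum (𝓞 L)) [w.asIdeal.LiesOver v.asIdeal] {ξ : galH1Torsion W n}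
    (hξ : resTorsion W L n ξ ∈ selmerLocalKer (W.baseChange L) (w.adicCompletion L) n) :
    2 • ξ ∈ selmerLocalKer W (v.adicCompletion K) n := by
  obtain ⟨hfin, hle⟩ := finrank_adicCompletion_le_of_liesOver L v w
  letI : Algebra (v.adicCompletion K) (w.adicCompletion L) := (adicCompletionMap (K := K) L v w).toAlgebra
  haveI : IsScalarTower K (v.adicCompletion K) (w.adicCompletion L) :=
    IsScalarTower.of_algebraMap_eq fun x ↦ (adicCompletionMap_coe (K := K) L v w x).symm
  haveI : FiniteDimensional (v.adicCompletion K) (w.adicCompletion L) := hfin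
  haveI : CharZero (v.adicCompletion K) := charZero_of_injective_algebraMap (algebraMap K (v.adicCompletion K)).injective
  rw [mem_selmerLocalKer_iff_torsionH1ToH1_mem, torsionH1ToH1_resTorsion] at hξ
  have hx : torsionH1ToH1 W n ξ ∈ W.localRestrictionKer (w.adicCompletion L) :=
    (mem_localRestrictionKer_iff_resBaseChange_mem W _).mpr hξ
  rw [mem_selmerLocalKer_iff_torsionH1ToH1_mem, map_nsmul]
  exact two_nsmul_mem_localRestrictionKer_of_tower W (E := v.adicCompletion K) (hle.trans h2) hx

/-- **Finite place, «every place of `L` above `v`» form** (the shape in which a Kolyvagin class is known to be Kummer at the places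
prime to its level): some `w ∣ v` exists (`exists_liesOver`). [cite: DokchitserDokchitserAnnals2010, Lemma 4.14 (proof)] -/
theorem two_nsmul_mem_selmerLocalKer_of_forall_liesOver (h2 : Module.finrank K L ≤ 2) (n : ℤ) (v : HeightOneSpectrum (𝓞 K))
    {ξ : galH1Torsion W n}
    (hξ : ∀ w : HeightOneSpectrum (𝓞 L), w.asIdeal.LiesOver v.asIdeal →
      resTorsion W L n ξ ∈ selmerLocalKer (W.baseChange L) (w.adicCompletion L) n) :
    2 • ξ ∈ selmerLocalKer W (v.adicCompletion K) n := by
  obtain ⟨w, hw⟩ := exists_liesOver L v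
  haveI := hw
  exact two_nsmul_mem_selmerLocalKer_of_resTorsion_mem W L h2 n v w (hξ w hw)

omit [NumberField L] [Algebra K L] in
/-- **Archimedean place: `2 • c ∈ ker(H¹(K, E) → H¹(K_w, E))` for EVERY class `c`** — the kernel has index `≤ 2`
(`index_localRestrictionKer_infinitePlace_le_two`: the quotient embeds in `H¹(K_w, E)`, of order `≤ 2`) and is of finite index, so
`index • c` lies in it (`AddSubgroup.nsmul_index_mem`). [cite: MilneADT2006, I Rem. 3.7] -/
theorem two_nsmul_mem_localRestrictionKer_infinitePlace [W.IsElliptic] (w : InfinitePlace K) (c : W.galH1) :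
    2 • c ∈ W.localRestrictionKer w.Completion := by
  have h2 := W.index_localRestrictionKer_infinitePlace_le_two w
  have hne : (W.localRestrictionKer w.Completion).index ≠ 0 := by
    haveI : Finite (W.localH1 w.Completion) := by
      rw [← galoisCohomology_localGaloisModule_one]
      exact W.finite_localH1_infinitePlace w
    rw [localRestrictionKer_eq_ker, AddSubgroup.index_ker]
    exact Nat.card_pos.ne'
  have hmem := (W.localRestrictionKer w.Completion).nsmul_index_mem c
  rcases Nat.le_succ_iff.mp h2 with h1 | h2'
  · -- index ≤ 1, hence = 1: the kernel is everything
    have h1' : (W.localRestrictionKer w.Completion).index = 1 := le_antisymm h1 (Nat.one_le_iff_ne_zero.mpr hne)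
    rw [h1', one_nsmul] at hmem
    exact AddSubgroup.nsmul_mem _ hmem 2
  · rwa [h2'] at hmem

omit [NumberField L] [Algebra K L] in
/-- **Archimedean place, level `n`: `2 • ξ ∈ selmerLocalKer W K_w n` for EVERY `ξ ∈ H¹(K, E[n])`** (preimage of the torsor-level
statement under `H¹(K, E[n]) → H¹(K, E)`).  In the engine: NO archimedean condition is ever asked of `X = 2Z`.
[cite: MilneADT2006, I Rem. 3.7] -/
theorem two_nsmul_mem_selmerLocalKer_infinitePlace [W.IsElliptic] (w : InfinitePlace K) (n : ℤ) (ξ : galH1Torsion W n) :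
    2 • ξ ∈ selmerLocalKer W w.Completion n := by
  rw [mem_selmerLocalKer_iff_torsionH1ToH1_mem, map_nsmul]
  exact two_nsmul_mem_localRestrictionKer_infinitePlace W w _

end Local

/-! ## §2 Packaging: the doubled class lies in `H¹_{𝓛,⊤ on T}` -/

section Package

variable {K : Type} [Field K] [NumberField K] (W : WeierstrassCurve K) [W.IsElliptic]
variable (L : Type) [Field L] [NumberField L] [Algebra K L]

/-- **The `hX` producer.**  For `[L : K] ≤ 2`, a level `m`, a finite set `T` of places of `K` and a class `ξ ∈ H¹(K, E[m])` whose
restriction to `L` satisfies the Kummer condition at every finite place of `L` above every finite place `v ∉ T` of `K`: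
`(2:ℕ) • ξ ∈ kummerOutside W m T` — Kummer at EVERY place outside `T`, the archimedean ones for free (§1).  With `K = ℚ`, `L` the
Heegner field, `ξ = Z` the descended Kolyvagin class and `T` its own primes this is the displayed `hX` of
`…RTBottomRungReciprocity.invWeilPairing_eq_zero_of_bottomRung` (after `insert`/`∪` bookkeeping on `T`).
[cite: DokchitserDokchitserAnnals2010, Lemma 4.14 (proof)] [cite: McCallumLMS1991, §4 Lemma 4.3] -/
theorem two_nsmul_mem_kummerOutside_of_forall_resTorsion_mem (h2 : Module.finrank K L ≤ 2) (m : ℕ) [NeZero m]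
    (T : Finset (Place K)) (ξ : galoisCohomology (W.torsionGaloisModule (m : ℤ)) 1)
    (hξ : ∀ v : HeightOneSpectrum (𝓞 K), (Sum.inr v : Place K) ∉ T →
      ∀ w : HeightOneSpectrum (𝓞 L), w.asIdeal.LiesOver v.asIdeal →
        resTorsion W L (m : ℤ) ξ ∈ selmerLocalKer (W.baseChange L) (w.adicCompletion L) (m : ℤ)) :
    (2 : ℕ) • ξ ∈ kummerOutside W m T := by
  refine (mem_kummerOutside_iff W m T _).mpr ?_
  rintro (w | v) hv
  · exact (res_mem_kummerLocalConditionAt_iff W (m : ℤ) (Place.Completion (Sum.inl w : Place K)) _).mpr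
      (two_nsmul_mem_selmerLocalKer_infinitePlace W w (m : ℤ) ξ)
  · exact (res_mem_kummerLocalConditionAt_iff W (m : ℤ) (Place.Completion (Sum.inr v : Place K)) _).mpr
      (two_nsmul_mem_selmerLocalKer_of_forall_liesOver W L h2 (m : ℤ) v (hξ v hv))

omit [W.IsElliptic] in
/-- **Selmer-group form.**  If `res_{L/K} ξ ∈ Sel^{(m)}(E_L/L)` then `(2:ℕ) • ξ ∈ kummerOutside W m T` for every `T` (indeed
`2 • ξ ∈ Sel^{(m)}(E/K)`, the tree's `two_nsmul_mem_selmerGroup_of_resTorsion_mem`, and `Sel ≤ kummerOutside`).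
[cite: DokchitserDokchitserAnnals2010, Lemma 4.14 (proof)] -/
theorem two_nsmul_mem_kummerOutside_of_resTorsion_mem_selmerGroup (h2 : Module.finrank K L ≤ 2) (m : ℕ) [NeZero m]
    (T : Finset (Place K)) (ξ : galoisCohomology (W.torsionGaloisModule (m : ℤ)) 1)
    (hξ : resTorsion W L (m : ℤ) ξ ∈ selmerGroup (W.baseChange L) (m : ℤ)) :
    (2 : ℕ) • ξ ∈ kummerOutside W m T :=
  selmerGroup_le_kummerOutside W m T (two_nsmul_mem_selmerGroup_of_resTorsion_mem L W (m : ℤ) h2 hξ)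

/-- **Relaxed outside `T`, arbitrary inside: the form with a `K`-side witness.**  If `y ∈ H¹(L, E_L[m])` is the restriction of `ξ`
and `y` satisfies the Kummer condition at every finite place `w` of `L` lying over a finite place `v ∉ T` of `K`, then
`(2:ℕ) • ξ ∈ kummerOutside W m T`.  (The shape of the engine: `y = c(nℓ′)` the Kolyvagin class, Kummer at all `w ∤ nℓ′`;
`ξ = Z` its descent.) [cite: McCallumLMS1991, §4 Lemma 4.3, Lemma 4.6] -/
theorem two_nsmul_mem_kummerOutside_of_resTorsion_eq (h2 : Module.finrank K L ≤ 2) (m : ℕ) [NeZero m]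
    (T : Finset (Place K)) (ξ : galoisCohomology (W.torsionGaloisModule (m : ℤ)) 1) (y : galH1Torsion (W.baseChange L) (m : ℤ))
    (hy : resTorsion W L (m : ℤ) ξ = y)
    (hKum : ∀ v : HeightOneSpectrum (𝓞 K), (Sum.inr v : Place K) ∉ T →
      ∀ w : HeightOneSpectrum (𝓞 L), w.asIdeal.LiesOver v.asIdeal →
        y ∈ selmerLocalKer (W.baseChange L) (w.adicCompletion L) (m : ℤ)) :
    (2 : ℕ) • ξ ∈ kummerOutside W m T :=
  two_nsmul_mem_kummerOutside_of_forall_resTorsion_mem W L h2 m T ξ fun v hv w hw ↦ hy ▸ hKum v hv w hw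

/-- **The engine's instance: `K = ℚ`, `L` the Heegner field.**  For an imaginary quadratic `L`, a curve `W/ℚ` (the curve or its
twin), a class `Z ∈ H¹(ℚ, E[m])` whose restriction to `L` is Kummer at every finite place of `L` above every prime `v ∉ T`:
`(2:ℕ) • Z ∈ kummerOutside W m T` — with no condition at `2`, at the primes of `d_L` (beyond the relaxed one) or at `∞`.
[cite: McCallumLMS1991, §4 Lemma 4.3, Lemma 4.6] [cite: DokchitserDokchitserAnnals2010, Lemma 4.14 (proof)] -/
theorem two_nsmul_mem_kummerOutside_of_isImaginaryQuadratic (W : WeierstrassCurve ℚ) [W.IsElliptic]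
    (L : Type) [Field L] [NumberField L] (hL : IsImaginaryQuadratic L) (m : ℕ) [NeZero m]
    (T : Finset (Place ℚ)) (Z : galoisCohomology (W.torsionGaloisModule (m : ℤ)) 1)
    (hZ : ∀ v : HeightOneSpectrum (𝓞 ℚ), (Sum.inr v : Place ℚ) ∉ T →
      ∀ w : HeightOneSpectrum (𝓞 L), w.asIdeal.LiesOver v.asIdeal →
        resTorsion W L (m : ℤ) Z ∈ selmerLocalKer (W.baseChange L) (w.adicCompletion L) (m : ℤ)) :
    (2 : ℕ) • Z ∈ kummerOutside W m T :=
  two_nsmul_mem_kummerOutside_of_forall_resTorsion_mem W L hL.1.le m T Z hZ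

end Package

end Summit.BirchSwinnertonDyer.BirchSwinnertonDyer.Theorems.GenusExact.RelaxedCount

end
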